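import Summits.ResolutionOfSingularities.ResolutionOfSingularities.Theorems.FrobeniusLadderFRationalResolutionDualLatticeWeights
import Literature.Geometry.PolyhedralFans.RegularRefinement
import Mathlib.LinearAlgebra.StdBasis
import HarnessLib

/-!
# Crux `FrobeniusLadder.FRationalResolution` (stmt-ResolutionOfSingularities-15317), line `redirect`,
# stub `stub_diagonalizableQuotientResolution` — the FAN-SIDE HYPOTHESES of the safe ladder from lattice conditions (lane W‴, T1)

`…SafeLadder.exists_equivariant_projective_ladder_safe` (✓ p831580) is applied with `S₀ = φ(e_•)` for the coordinate change
`φ` of `…DualLatticeWeights` (✓ p831688). This file discharges its hypotheses about `S₀` from conditions on the dual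
lattice `N` (`v ∈ N ↔ φ v ∈ ℤⁿ`): linear independence, cardinality, finite generation and salience of `hull S₀` are free;
PRIMITIVITY of `φ(e_l)` is "no lattice point strictly between `0` and `e_l`" (no pseudo-reflection along the axis `l`);
REGULARITY of every proper subfamily is "every lattice point supported on a proper set `I` of coordinates is integral"
(the singularity is ISOLATED: every proper coordinate face of the orthant is regular).

* `linearIndepOn_image_single`, `card_image_single`, `fg_hull_image_single`, `isSalient_hull_of_linearIndepOn` — free hypotheses;
* `isPrimitive_map_single` — `hprim` from the no-pseudo-reflection condition;
* `isRegularGens_of_ssubset_image_single` — `hiso` from the isolatedness condition.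

Honest label: linear algebra bookkeeping for the DESIGN W‴ (brick T1; the group `G` of the twisted chart comparison is NOT
constructed here). No stub closed by name. No definitions, no named facts, no sorry. [folklore; cite: Fulton1993Toric, §2.1 p. 29]
-/

-- single-problem summit: the doubled namespace component is forced
set_option linter.dupNamespace false

namespace Summit.ResolutionOfSingularities.ResolutionOfSingularities.Theorems.FRationalResolution.IsolatedConeHypotheses

open Literature.Geometry.PolyhedralFans PointedCone Finset

variable {n : ℕ}

/-- `S₀ = φ(e_•)` is linearly independent. [folklore] -/
theorem linearIndepOn_image_single (φ : (Fin n → ℚ) ≃ₗ[ℚ] (Fin n → ℚ)) :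
    LinearIndepOn ℚ id ((Finset.univ.image fun l : Fin n => φ (Pi.single l (1 : ℚ))) : Set (Fin n → ℚ)) := by
  classical
  have h0 : LinearIndependent ℚ (fun l : Fin n => (Pi.single l (1 : ℚ) : Fin n → ℚ)) := by
    convert (Pi.basisFun ℚ (Fin n)).linearIndependent using 1
    ext l i
    simp [Pi.basisFun_apply]
  have h : LinearIndependent ℚ (fun l : Fin n => φ (Pi.single l (1 : ℚ))) :=
    h0.map' (φ : (Fin n → ℚ) →ₗ[ℚ] (Fin n → ℚ)) (LinearEquiv.ker φ)
  refine h.linearIndepOn_id' ?_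
  rw [Finset.coe_image, Finset.coe_univ, Set.image_univ]

/-- `S₀ = φ(e_•)` has `n` elements. [folklore] -/
theorem card_image_single (φ : (Fin n → ℚ) ≃ₗ[ℚ] (Fin n → ℚ)) :
    (Finset.univ.image fun l : Fin n => φ (Pi.single l (1 : ℚ))).card = n := by
  classical
  rw [Finset.card_image_of_injective _ ?_, Finset.card_univ, Fintype.card_fin]
  intro l l' h
  have h' : (Pi.single l (1 : ℚ) : Fin n → ℚ) = Pi.single l' 1 := φ.injective h
  by_contra hne
  have := congrFun h' l
  simp [hne] at this

/-- The hull of a finite set is finitely generated. [folklore] -/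
theorem fg_hull_finset (S : Finset (Fin n → ℚ)) : (PointedCone.hull ℚ (S : Set (Fin n → ℚ))).FG :=
  ⟨S, rfl⟩

/-- **The hull of a linearly independent finite family is salient**: if `x` and `-x` are non-negative combinations, the sum of
the two coefficient vectors represents `0`, so all coefficients vanish. [folklore; cite: Fulton1993Toric, §1.2 p. 14] -/
theorem isSalient_hull_of_linearIndepOn {S : Finset (Fin n → ℚ)} (hli : LinearIndepOn ℚ id (S : Set (Fin n → ℚ))) :
    IsSalient (PointedCone.hull ℚ (S : Set (Fin n → ℚ))) := by
  intro x hx hnx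
  obtain ⟨a, ha, hax⟩ := mem_hull_finset_iff.mp hx
  obtain ⟨b, hb, hbx⟩ := mem_hull_finset_iff.mp hnx
  have hsum : ∑ s ∈ S, (fun s => a s + b s) s • s = ∑ s ∈ S, (fun _ => (0 : ℚ)) s • s := by
    simp only [add_smul, Finset.sum_add_distrib, hax, hbx, zero_smul, Finset.sum_const_zero, add_neg_cancel]
  have hab := eq_on_of_sum_smul_eq hli hsum
  have ha0 : ∀ s ∈ S, a s = 0 := fun s hs => by
    have h : a s + b s = 0 := hab s hs
    have h1 := ha s hs
    have h2 := hb s hs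
    linarith
  rw [← hax]
  exact Finset.sum_eq_zero fun s hs => by rw [ha0 s hs, zero_smul]

/-- **`hprim` from the no-pseudo-reflection condition.** If `v ∈ N ↔ φ v ∈ ℤⁿ` and no `q • e_l` with `0 < q < 1` lies in `N`
(precisely: `q > 0`, `q • e_l ∈ N ⇒ 1 ≤ q`), then `φ(e_l)` is a primitive vector of `ℤⁿ`. [folklore; cite: Fulton1993Toric, §2.1 p. 29] -/
theorem isPrimitive_map_single (φ : (Fin n → ℚ) ≃ₗ[ℚ] (Fin n → ℚ)) {N : Set (Fin n → ℚ)}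
    (hφ : ∀ v, v ∈ N ↔ φ v ∈ latticeN (Fin n)) (l : Fin n) (hl : (Pi.single l (1 : ℚ) : Fin n → ℚ) ∈ N)
    (hnpr : ∀ q : ℚ, 0 < q → q • (Pi.single l (1 : ℚ) : Fin n → ℚ) ∈ N → 1 ≤ q) :
    IsPrimitive (φ (Pi.single l (1 : ℚ))) := by
  refine ⟨(hφ _).1 hl, fun h0 => ?_, fun c hc hcN => hnpr c hc ((hφ _).2 (by rwa [map_smul]))⟩
  have h' : (Pi.single l (1 : ℚ) : Fin n → ℚ) = 0 := φ.injective (by rw [h0, map_zero])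
  have := congrFun h' l
  simp at this

/-- **`hiso` from isolatedness.** Suppose `v ∈ N ↔ φ v ∈ ℤⁿ`, the coordinate vectors lie in `N`, and every vector of `N`
supported on a PROPER set of coordinates is integral. Then every proper subfamily of `S₀ = φ(e_•)` is regular
(its `ℤ`-span is saturated in `ℤⁿ`). [folklore; cite: Fulton1993Toric, §2.1 p. 29] -/
theorem isRegularGens_of_ssubset_image_single (φ : (Fin n → ℚ) ≃ₗ[ℚ] (Fin n → ℚ)) {N : Set (Fin n → ℚ)}
    (hφ : ∀ v, v ∈ N ↔ φ v ∈ latticeN (Fin n)) (hsub : ∀ l : Fin n, (Pi.single l (1 : ℚ) : Fin n → ℚ) ∈ N)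
    (hiso : ∀ v ∈ N, (∃ l, v l = 0) → v ∈ latticeN (Fin n))
    {J : Finset (Fin n → ℚ)} (hJ : J ⊂ Finset.univ.image fun l : Fin n => φ (Pi.single l (1 : ℚ))) :
    IsRegularGens J := by
  classical
  obtain ⟨hJsub, hJne⟩ := Finset.ssubset_iff_subset_ne.mp hJ
  refine ⟨fun s hs => ?_, (linearIndepOn_image_single φ).mono (Finset.coe_subset.mpr hJsub), fun x hxN hxJ => ?_⟩
  · obtain ⟨l, -, rfl⟩ := Finset.mem_image.mp (hJsub hs)
    exact (hφ _).1 (hsub l)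
  · -- a coordinate `l₀` with `φ(e_{l₀}) ∉ J`
    obtain ⟨l₀, hl₀⟩ : ∃ l₀ : Fin n, φ (Pi.single l₀ (1 : ℚ)) ∉ J := by
      by_contra h
      push Not at h
      exact hJne (Finset.Subset.antisymm hJsub fun s hs => by
        obtain ⟨l, -, rfl⟩ := Finset.mem_image.mp hs
        exact h l)
    -- `v = φ⁻¹ x` is supported off `l₀`
    set v := φ.symm x with hv
    have hvN : v ∈ N := (hφ v).2 (by rw [hv, LinearEquiv.apply_symm_apply]; exact hxN)
    have hvspan : v ∈ Submodule.span ℚ ((J.image φ.symm : Finset (Fin n → ℚ)) : Set (Fin n → ℚ)) := by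
      have h := Submodule.apply_mem_span_image_of_mem_span (φ.symm : (Fin n → ℚ) →ₗ[ℚ] (Fin n → ℚ)) hxJ
      rw [Finset.coe_image, hv]
      exact h
    have hJsymm : ∀ t ∈ J.image φ.symm, ∃ l, l ≠ l₀ ∧ t = Pi.single l 1 := by
      intro t ht
      obtain ⟨s, hs, rfl⟩ := Finset.mem_image.mp ht
      obtain ⟨l, -, rfl⟩ := Finset.mem_image.mp (hJsub hs)
      refine ⟨l, fun h => hl₀ (h ▸ hs), by simp⟩
    have hvl₀ : v l₀ = 0 := by
      obtain ⟨c, -, hc⟩ := Submodule.mem_span_finset.mp hvspan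
      rw [← hc, Finset.sum_apply]
      refine Finset.sum_eq_zero fun t ht => ?_
      obtain ⟨l, hl, rfl⟩ := hJsymm t ht
      simp [hl.symm]
    have hvZ : v ∈ latticeN (Fin n) := hiso v hvN ⟨l₀, hvl₀⟩
    -- integral expansion of `v` along the coordinates in `J`
    rw [mem_latticeN_iff] at hvZ
    choose z hz using hvZ
    have hsupp : ∀ l, φ (Pi.single l (1 : ℚ)) ∉ J → v l = 0 := by
      intro l hl
      obtain ⟨c, -, hc⟩ := Submodule.mem_span_finset.mp hvspan
      rw [← hc, Finset.sum_apply]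
      refine Finset.sum_eq_zero fun t ht => ?_
      obtain ⟨s, hs, rfl⟩ := Finset.mem_image.mp ht
      obtain ⟨l', -, rfl⟩ := Finset.mem_image.mp (hJsub hs)
      have hne : l' ≠ l := fun h => hl (h ▸ hs)
      simp [hne.symm]
    have hxeq : x = ∑ l ∈ Finset.univ.filter (fun l => φ (Pi.single l (1 : ℚ)) ∈ J),
        (z l : ℚ) • φ (Pi.single l (1 : ℚ)) := by
      have hv' : v = ∑ l, v l • (Pi.single l (1 : ℚ) : Fin n → ℚ) := by
        ext i; rw [Finset.sum_apply]; simp [Pi.single_apply]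
      calc x = φ v := by rw [hv, LinearEquiv.apply_symm_apply]
        _ = ∑ l, v l • φ (Pi.single l (1 : ℚ)) := by
          conv_lhs => rw [hv']
          simp [map_sum, map_smul]
        _ = _ := by
          rw [← Finset.sum_filter_add_sum_filter_not Finset.univ (fun l => φ (Pi.single l (1 : ℚ)) ∈ J)]
          have hzero : ∑ l ∈ Finset.univ.filter (fun l => ¬ φ (Pi.single l (1 : ℚ)) ∈ J),
              v l • φ (Pi.single l (1 : ℚ)) = 0 :=
            Finset.sum_eq_zero fun l hl => by rw [hsupp l (Finset.mem_filter.mp hl).2, zero_smul]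
          rw [hzero, add_zero]
          exact Finset.sum_congr rfl fun l _ => by rw [hz l]
    rw [hxeq]
    refine Submodule.sum_mem _ fun l hl => ?_
    rw [Int.cast_smul_eq_zsmul]
    exact Submodule.smul_mem _ _ (Submodule.subset_span (Finset.mem_coe.mpr (Finset.mem_filter.mp hl).2))

end Summit.ResolutionOfSingularities.ResolutionOfSingularities.Theorems.FRationalResolution.IsolatedConeHypotheses
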